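import Literature.Probability.RandomPlanarGeometry.CardyFunction

/-!
# Stub `stub_cardyLog` (C) of line `two-cluster-rate-is-stationary-gap`
# (crux `CardyBoundaryCoulombGas.StripClusterRates`, stmt-CriticalPhenomena-13878)

**C · CARDY LOG.** Cardy's function `F(η) = cardyConst · η^{1/3} · ₂F₁(1/3, 2/3; 4/3; η)`
satisfies `log F(η) / log η → 1/3` as `η → 0⁺`, i.e. `F(η) = cardyConst · η^{1/3} · (1 + o(1))`.
This is the source of the factor `1/3` in the strip crossing rate `n · γ₁(n) → π/3` of the line
(Cardy order: crossing probability `→ F(λ(iA))`, `λ(iA) → 0`, `log λ(iA) / A → -π`).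

Proof: for `0 < η < 1` with `₂F₁(…; η) > 0`,
`log F(η) / log η = 1/3 + (log cardyConst + log ₂F₁(1/3,2/3;4/3;η)) / log η`;
the hypergeometric factor is continuous at `0` with value `1` (it is given by its Gauss series on
the unit ball, `Literature…ordinaryHypergeometric_hasFPowerSeriesOnBall`, and Mathlib's
`ordinaryHypergeometric_zero`), so the numerator of the error term tends to the constant
`log cardyConst` while `log η → -∞` (Mathlib `Real.tendsto_log_nhdsGT_zero`).

Sources: J. Cardy, J. Phys. A 25 (1992) L201, eq. (11); Gauss 1812 (the series).
-/

noncomputable section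

namespace Summit.CriticalPhenomena.CardyFormulaZ2.Cruxes.StripClusterRates.TwoClusterRateIsStationaryGap

open Filter Topology
open Literature.Probability.RandomPlanarGeometry

/-- The hypergeometric factor `₂F₁(1/3, 2/3; 4/3; η)` of Cardy's function tends to `1` as
`η → 0` (it is the sum of its Gauss series on the unit ball, with constant term `1`). [folklore] -/
theorem cardyLog_tendsto_hypergeometric_nhds_zero :
    Tendsto (₂F₁ (1 / 3 : ℝ) (2 / 3 : ℝ) (4 / 3 : ℝ) : ℝ → ℝ) (𝓝 0) (𝓝 1) := by
  have h : ContinuousAt (₂F₁ (1 / 3 : ℝ) (2 / 3 : ℝ) (4 / 3 : ℝ) : ℝ → ℝ) 0 :=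
    (ordinaryHypergeometric_hasFPowerSeriesOnBall (𝔸 := ℝ) (1 / 3 : ℝ) (2 / 3) (4 / 3)
      cardy_params_ne_neg_nat).hasFPowerSeriesAt.continuousAt
  have h0 : (₂F₁ (1 / 3 : ℝ) (2 / 3 : ℝ) (4 / 3 : ℝ) : ℝ → ℝ) 0 = 1 :=
    ordinaryHypergeometric_zero _ _ _
  simpa [ContinuousAt, h0] using h

/-- For `0 < η < 1` with positive hypergeometric factor, the explicit decomposition
`log F(η) / log η = (log cardyConst + log ₂F₁(1/3,2/3;4/3;η)) / log η + 1/3`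
(`Real.log_mul`, `Real.log_rpow`). [folklore] -/
theorem cardyLog_log_div_log_eq {η : ℝ} (hη : η ∈ Set.Ioo (0 : ℝ) 1)
    (hG : 0 < ₂F₁ (1 / 3 : ℝ) (2 / 3 : ℝ) (4 / 3 : ℝ) η) :
    Real.log (cardyFunction η) / Real.log η =
      (Real.log cardyConst + Real.log (₂F₁ (1 / 3 : ℝ) (2 / 3 : ℝ) (4 / 3 : ℝ) η)) / Real.log η
        + 1 / 3 := by
  have hη0 : 0 < η := hη.1
  have hlogη : Real.log η ≠ 0 := (Real.log_neg hη0 hη.2).ne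
  have hrpow : 0 < η ^ (1 / 3 : ℝ) := Real.rpow_pos_of_pos hη0 _
  rw [cardyFunction_eq_cardyConst_mul, Real.log_mul (mul_pos cardyConst_pos hrpow).ne' hG.ne',
    Real.log_mul cardyConst_pos.ne' hrpow.ne', Real.log_rpow hη0]
  field_simp
  ring

/-- **C — `stub_cardyLog`.** `log F(η) / log η → 1/3` as `η → 0⁺`, where `F = cardyFunction` is
Cardy's function `cardyConst · η^{1/3} · ₂F₁(1/3, 2/3; 4/3; η)`: the hypergeometric factor tends
to `1`, so `log F(η) = log cardyConst + (1/3) log η + o(1)` while `log η → -∞`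
(Cardy 1992, eq. (11)). [folklore] -/
theorem stub_cardyLog :
    Tendsto (fun η : ℝ ↦ Real.log (Literature.Probability.RandomPlanarGeometry.cardyFunction η) / Real.log η)
      (𝓝[>] 0) (𝓝 (1 / 3 : ℝ)) := by
  have hG : Tendsto (₂F₁ (1 / 3 : ℝ) (2 / 3 : ℝ) (4 / 3 : ℝ) : ℝ → ℝ) (𝓝[>] 0) (𝓝 1) :=
    cardyLog_tendsto_hypergeometric_nhds_zero.mono_left nhdsWithin_le_nhds
  -- the numerator of the error term tends to the constant `log cardyConst + log 1`
  have hnum : Tendsto (fun η : ℝ ↦ Real.log cardyConst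
      + Real.log (₂F₁ (1 / 3 : ℝ) (2 / 3 : ℝ) (4 / 3 : ℝ) η)) (𝓝[>] 0)
      (𝓝 (Real.log cardyConst + Real.log 1)) :=
    tendsto_const_nhds.add (hG.log one_ne_zero)
  -- divided by `log η → -∞` it tends to `0`
  have herr : Tendsto (fun η : ℝ ↦ (Real.log cardyConst
      + Real.log (₂F₁ (1 / 3 : ℝ) (2 / 3 : ℝ) (4 / 3 : ℝ) η)) / Real.log η) (𝓝[>] 0) (𝓝 0) :=
    hnum.div_atBot Real.tendsto_log_nhdsGT_zero
  have hmain : Tendsto (fun η : ℝ ↦ (Real.log cardyConst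
      + Real.log (₂F₁ (1 / 3 : ℝ) (2 / 3 : ℝ) (4 / 3 : ℝ) η)) / Real.log η + 1 / 3)
      (𝓝[>] 0) (𝓝 (1 / 3 : ℝ)) := by
    simpa using herr.add_const (1 / 3 : ℝ)
  refine hmain.congr' ?_
  have hGpos : ∀ᶠ η in 𝓝[>] (0 : ℝ), 0 < ₂F₁ (1 / 3 : ℝ) (2 / 3 : ℝ) (4 / 3 : ℝ) η :=
    hG.eventually (lt_mem_nhds one_pos)
  have hlt : ∀ᶠ η in 𝓝[>] (0 : ℝ), η ∈ Set.Ioo (0 : ℝ) 1 := Ioo_mem_nhdsGT one_pos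
  filter_upwards [hGpos, hlt] with η hGη hη
  exact (cardyLog_log_div_log_eq hη hGη).symm

end Summit.CriticalPhenomena.CardyFormulaZ2.Cruxes.StripClusterRates.TwoClusterRateIsStationaryGap
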